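import Literature.NumberTheory.GaloisRepresentations.AbsIntegersEquiv
import Literature.NumberTheory.GaloisRepresentations.AbsGaloisOuterConj
import Literature.NumberTheory.GaloisRepresentations.SatakeFamilyOfFramedGaloisRep
import Mathlib.FieldTheory.Galois.Basic
import Mathlib.GroupTheory.Solvable
import HarnessLib

/-!
# Brauer–Taylor descent for `PotentialCompanionDescent.BrauerTaylorDescent` — Galois transport

Galois-side bookkeeping for the Brauer–Taylor ("virtual Brauer induction") descent of companions
(Barnet-Lamb–Gee–Geraghty–Taylor 2014, Thm. 5.5.1; BLGHT / Harris' tensor-product trick), part 2a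
of the lineage programme whose part 1 (`…BrauerSolvable`, `…BrauerPairing`, `…DescentData`)
supplies the Brauer half.  For a finite Galois extension `L/K` of number fields with group
`Q = Gal(L/K)`, quotient map `π = absGaloisQuot K L : Γ_K → Q` and an intermediate field
`E = L^{H̄}`:

* `exists_conj_range_absGaloisRestrict_iff` — the image `res(Γ_E) ⊆ Γ_K` of the restriction from
  the absolute Galois group of the (abstract) field `E` is a `Γ_K`-conjugate of `π⁻¹(Fix_Q(E))`;
* `isSolvable_gal_fixedField` — `Gal(L/L^{H̄}) ≅ H̄` is solvable when `H̄` is;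
* `exists_isArithFrobAt_of_absGaloisRestrict`, `exists_mem_inertia_of_absGaloisRestrict` — if
  `res(τ)`, `τ ∈ Γ_M`, is an arithmetic Frobenius (resp. an inertia element) of `K` at a prime
  `𝔓 ∣ v`, then `τ` is an arithmetic Frobenius (resp. inertia element) of `M` at the transported
  prime `𝔔 ∣ w ∣ v`, and `N w = N v` (the residue degree of `w ∣ v` is `1`);
* consequences for framed representations: companions matching over `M` give matching Frobenius
  polynomials at such `res(τ)` (`exists_charpoly_eq_of_companion`), unramified over `M` gives
  trivial on transported inertia (`apply_eq_one_of_absGaloisRestrict_mem_inertia`), and the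
  cofinite bookkeeping `eventually_forall_under`.

References: Neukirch, *Algebraic Number Theory*, Ch. I §9; Barnet-Lamb–Gee–Geraghty–Taylor,
*Potential automorphy and change of weight*, Ann. of Math. 179 (2014), proof of Thm. 5.5.1.
-/

set_option linter.dupNamespace false

noncomputable section

open Field IsDedekindDomain NumberField Polynomial
open Literature.NumberTheory.GaloisRepresentations Literature.NumberTheory.Automorphic
open scoped NumberField Pointwise

namespace Summit.Langlands.Langlands.Theorems.BrauerTaylorDescent

/-! ### The image of `Γ_E → Γ_K` for an intermediate field `E` of `L/K` -/

section RangeConj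

variable (K L : Type) [Field K] [Field L] [Algebra K L] [IsGalois K L]

/-- `δ ∈ π⁻¹(Fix_Q(E))` iff `δ` fixes the copy `e_L(E) ⊆ K̄` pointwise. [folklore] -/
theorem mem_comap_absGaloisQuot_fixingSubgroup_iff (E : IntermediateField K L)
    (δ : absoluteGaloisGroup K) :
    δ ∈ (E.fixingSubgroup).comap (absGaloisQuot K L) ↔
      ∀ x : E, δ • absEmbedding K L (x : L) = absEmbedding K L (x : L) := by
  rw [Subgroup.mem_comap, IntermediateField.mem_fixingSubgroup_iff]
  refine ⟨fun h x => ?_, fun h x hx => ?_⟩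
  · rw [← absEmbedding_absGaloisQuot_apply, h x x.2]
  · apply (absEmbedding K L).injective
    change absEmbedding K L (absGaloisQuot K L δ x) = absEmbedding K L x
    rw [absEmbedding_absGaloisQuot_apply]
    exact h ⟨x, hx⟩

/-- **`res(Γ_E)` is conjugate to `π⁻¹(Fix_Q(E))`.**  For an intermediate field `E` of the finite
Galois extension `L/K`, the image of the restriction `Γ_E → Γ_K` (built from the chosen
`K̄ ≅ Ē`) is `c · π⁻¹(Fix_Q(E)) · c⁻¹` for some `c ∈ Γ_K` (`c` carries the copy `e_L(E)` of `E`
inside `K̄` to the copy cut out by `res(Γ_E)`).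
Ref: Neukirch, *Algebraic Number Theory*, Ch. IV §1; Milne, *Fields and Galois Theory*, §7.
[folklore] -/
theorem exists_conj_range_absGaloisRestrict_iff (E : IntermediateField K L) :
    ∃ c : absoluteGaloisGroup K, ∀ γ : absoluteGaloisGroup K,
      γ ∈ (absGaloisRestrict K E).range ↔
        c⁻¹ * γ * c ∈ (E.fixingSubgroup).comap (absGaloisQuot K L) := by
  obtain ⟨e, he⟩ := exists_mem_range_absGaloisRestrict_iff K E
  let φ : E →ₐ[K] AlgebraicClosure K := (absEmbedding K L).comp E.val
  obtain ⟨g, hg⟩ : ∃ g : absoluteGaloisGroup K, ∀ x : E, g • φ x = e x := by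
    letI : Algebra E (AlgebraicClosure K) := φ.toRingHom.toAlgebra
    haveI : IsScalarTower K E (AlgebraicClosure K) :=
      IsScalarTower.of_algebraMap_eq fun x => (φ.commutes x).symm
    let Φ : AlgebraicClosure K →ₐ[K] AlgebraicClosure K := e.liftNormal (AlgebraicClosure K)
    let g : AlgebraicClosure K ≃ₐ[K] AlgebraicClosure K :=
      AlgEquiv.ofBijective Φ (AlgHom.normal_bijective K _ _ Φ)
    refine ⟨(absoluteGaloisGroup.toAlgEquiv K).symm g, fun x => ?_⟩
    rw [absoluteGaloisGroup.toAlgEquiv_symm_apply]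
    change Φ (algebraMap E (AlgebraicClosure K) x) = e x
    rw [AlgHom.liftNormal_commutes]
    rfl
  refine ⟨g, fun γ => ?_⟩
  rw [he γ, mem_comap_absGaloisQuot_fixingSubgroup_iff]
  refine forall_congr' fun x => ?_
  rw [show absEmbedding K L (x : L) = φ x from rfl, ← hg x, mul_smul, mul_smul, inv_smul_eq_iff]

/-- With `E = L^{H̄}`: `res(Γ_{L^{H̄}}) = c · π⁻¹(H̄) · c⁻¹`. [folklore] -/
theorem exists_conj_range_absGaloisRestrict_fixedField_iff [FiniteDimensional K L]
    (H : Subgroup (L ≃ₐ[K] L)) :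
    ∃ c : absoluteGaloisGroup K, ∀ γ : absoluteGaloisGroup K,
      γ ∈ (absGaloisRestrict K (IntermediateField.fixedField H)).range ↔
        c⁻¹ * γ * c ∈ H.comap (absGaloisQuot K L) := by
  obtain ⟨c, hc⟩ := exists_conj_range_absGaloisRestrict_iff K L (IntermediateField.fixedField H)
  refine ⟨c, fun γ => ?_⟩
  rw [hc γ, IntermediateField.fixingSubgroup_fixedField H]

omit [IsGalois K L] in
/-- `Gal(L/L^{H̄}) ≅ H̄` is solvable when `H̄` is. [folklore] -/
theorem isSolvable_gal_fixedField [FiniteDimensional K L] (H : Subgroup (L ≃ₐ[K] L))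
    (hH : IsSolvable H) :
    IsSolvable (L ≃ₐ[IntermediateField.fixedField H] L) := by
  haveI : IsSolvable (IntermediateField.fixedField H).fixingSubgroup := by
    rw [IntermediateField.fixingSubgroup_fixedField H]
    exact hH
  exact solvable_of_surjective
    (f := (IntermediateField.fixingSubgroupEquiv (IntermediateField.fixedField H)).toMonoidHom)
    (IntermediateField.fixingSubgroupEquiv (IntermediateField.fixedField H)).surjective

/-- Every element of `Γ_K` whose image in `Q` lies in a conjugate `q H̄ q⁻¹` lies in a
`Γ_K`-conjugate of `π⁻¹(H̄)`: `∃ d, d⁻¹ γ d ∈ π⁻¹(H̄)`. [folklore] -/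
theorem exists_conj_mem_comap_of_mem_conj (H : Subgroup (L ≃ₐ[K] L)) (γ : absoluteGaloisGroup K)
    (q : L ≃ₐ[K] L) (h : q⁻¹ * absGaloisQuot K L γ * q ∈ H) :
    ∃ d : absoluteGaloisGroup K, d⁻¹ * γ * d ∈ H.comap (absGaloisQuot K L) := by
  obtain ⟨d, rfl⟩ := absGaloisQuot_surjective K L q
  exact ⟨d, by rwa [Subgroup.mem_comap, map_mul, map_mul, map_inv]⟩

end RangeConj

/-! ### Transport of primes, inertia and Frobenius along `res : Γ_M → Γ_K` -/

section PrimeTransport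

variable {K M : Type} [Field K] [NumberField K] [Field M] [NumberField M] [Algebra K M]

omit [NumberField M] in
/-- `Γ_M` fixes `𝓞 M ⊆ \bar ℤ_M` pointwise. [folklore] -/
theorem smul_algebraMap_ringOfIntegers (τ : absoluteGaloisGroup M) (y : 𝓞 M) :
    τ • algebraMap (𝓞 M) (absIntegers (𝓞 M) M) y = algebraMap (𝓞 M) (absIntegers (𝓞 M) M) y := by
  apply Subtype.ext
  change τ • ((algebraMap (𝓞 M) (absIntegers (𝓞 M) M) y : AlgebraicClosure M)) = _
  rw [Subalgebra.coe_algebraMap, absoluteGaloisGroup.smul_def]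
  change (absoluteGaloisGroup.toAlgEquiv M τ) (algebraMap M (AlgebraicClosure M) (y : M)) =
    algebraMap M (AlgebraicClosure M) (y : M)
  exact AlgEquiv.commutes _ _

/-- **Residue degree one.**  If some `τ ∈ Γ_M` acts on `\bar ℤ_M / 𝔔` as `z ↦ z ^ (N v)` for a
prime `𝔔 ∣ w` of `\bar ℤ_M`, `w ∣ v`, then `N w = N v`: the residue field `k_w` is fixed by `τ`,
so `a ^ (N v) = a` on `k_w`, whence `#k_w ≤ N v` (`X ^ (N v) - X` has at most `N v` roots),
while `N w = (N v)^{f(w|v)} ≥ N v`. Ref: Neukirch, *Algebraic Number Theory*,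
Ch. I §9, (9.4)–(9.5). [folklore] -/
theorem residueCard_eq_of_forall_smul_sub_pow_mem {v : HeightOneSpectrum (𝓞 K)}
    {w : HeightOneSpectrum (𝓞 M)} (hw : w.asIdeal.under (𝓞 K) = v.asIdeal)
    {𝔔 : Ideal (absIntegers (𝓞 M) M)} (h𝔔 : 𝔔 ∈ w.primesAbove) {τ : absoluteGaloisGroup M}
    (hτ : ∀ z : absIntegers (𝓞 M) M, τ • z - z ^ v.residueCard ∈ 𝔔) :
    w.residueCard = v.residueCard := by
  classical
  haveI : 𝔔.IsPrime := h𝔔.1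
  haveI : 𝔔.LiesOver w.asIdeal := h𝔔.2
  haveI : w.asIdeal.IsMaximal := w.isPrime.isMaximal w.ne_bot
  haveI : v.asIdeal.IsMaximal := v.isPrime.isMaximal v.ne_bot
  -- `N w = (N v) ^ f ≥ N v`
  have hge : v.residueCard ≤ w.residueCard := by
    haveI : w.asIdeal.LiesOver v.asIdeal := ⟨hw.symm⟩
    rw [HeightOneSpectrum.residueCard, HeightOneSpectrum.residueCard,
      Ideal.absNorm_eq_pow_inertiaDeg'_of_liesOver w.asIdeal v.asIdeal v.isPrime v.ne_bot,
      Ideal.inertiaDeg'_eq_inertiaDeg v.asIdeal w.asIdeal]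
    exact Nat.le_self_pow (Ideal.inertiaDeg_pos w.asIdeal (𝓞 K)).ne' _
  refine le_antisymm ?_ hge
  -- the residue field `k_w = 𝓞 M ⧸ w` embeds in `\bar ℤ_M ⧸ 𝔔`, where `a ^ (N v) = a`
  letI : Field (𝓞 M ⧸ w.asIdeal) := Ideal.Quotient.field w.asIdeal
  have hk : Nat.card (𝓞 M ⧸ w.asIdeal) = w.residueCard := by
    rw [HeightOneSpectrum.residueCard, Ideal.absNorm_apply, Submodule.cardQuot_apply]
  haveI hfin : Finite (𝓞 M ⧸ w.asIdeal) := by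
    apply Nat.finite_of_card_ne_zero
    rw [hk]
    exact (zero_lt_one.trans w.one_lt_residueCard).ne'
  have hpow : ∀ a : 𝓞 M ⧸ w.asIdeal, a ^ v.residueCard = a := by
    intro a
    obtain ⟨y, rfl⟩ := Ideal.Quotient.mk_surjective a
    apply FaithfulSMul.algebraMap_injective (𝓞 M ⧸ w.asIdeal) (absIntegers (𝓞 M) M ⧸ 𝔔)
    rw [map_pow, Ideal.Quotient.algebraMap_mk_of_liesOver, ← map_pow, Ideal.Quotient.eq]
    have h1 := hτ (algebraMap (𝓞 M) (absIntegers (𝓞 M) M) y)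
    rw [smul_algebraMap_ringOfIntegers] at h1
    have := 𝔔.neg_mem h1
    rwa [neg_sub] at this
  -- every element of `k_w` is a root of `X ^ (N v) - X`, which has at most `N v` roots
  letI := Fintype.ofFinite (𝓞 M ⧸ w.asIdeal)
  have hq1 : 1 < v.residueCard := v.one_lt_residueCard
  have hroots : (Finset.univ : Finset (𝓞 M ⧸ w.asIdeal)) ⊆
      (X ^ v.residueCard - X : (𝓞 M ⧸ w.asIdeal)[X]).roots.toFinset := by
    intro a _
    rw [Multiset.mem_toFinset, mem_roots (FiniteField.X_pow_card_sub_X_ne_zero _ hq1), IsRoot,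
      eval_sub, eval_pow, eval_X, hpow, sub_self]
  calc w.residueCard = Fintype.card (𝓞 M ⧸ w.asIdeal) := by rw [← hk, Nat.card_eq_fintype_card]
    _ ≤ (X ^ v.residueCard - X : (𝓞 M ⧸ w.asIdeal)[X]).roots.toFinset.card :=
        Finset.card_le_card hroots
    _ ≤ Multiset.card (X ^ v.residueCard - X : (𝓞 M ⧸ w.asIdeal)[X]).roots :=
        Multiset.toFinset_card_le _
    _ ≤ (X ^ v.residueCard - X : (𝓞 M ⧸ w.asIdeal)[X]).natDegree := card_roots' _
    _ = v.residueCard := FiniteField.X_pow_card_sub_X_natDegree_eq _ hq1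

/-- The prime of `\bar ℤ_M` corresponding to a prime `𝔓` of `\bar ℤ_K` under `\bar ℤ_K ≅ \bar ℤ_M`
contracts back to `𝔓`. [folklore] -/
theorem comap_absIntegersMap_map (𝔓 : Ideal (absIntegers (𝓞 K) K)) :
    (𝔓.map (absIntegersMap K M)).comap (absIntegersMap K M) = 𝔓 :=
  Ideal.comap_map_of_bijective _ ⟨absIntegersMap_injective K M, absIntegersMap_surjective K M⟩

/-- … and is prime if `𝔓` is. [folklore] -/
theorem isPrime_map_absIntegersMap (𝔓 : Ideal (absIntegers (𝓞 K) K)) [𝔓.IsPrime] :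
    (𝔓.map (absIntegersMap K M)).IsPrime :=
  Ideal.map_isPrime_of_surjective (absIntegersMap_surjective K M)
    (by rw [(RingHom.injective_iff_ker_eq_bot _).1 (absIntegersMap_injective K M)]; exact bot_le)

/-- **Inertia descends along `res`.**  If `res(τ) ∈ I_𝔓 ⊆ Γ_K` for a prime `𝔓 ∣ v` of `\bar ℤ_K`,
then `τ ∈ I_𝔔 ⊆ Γ_M` for a prime `𝔔` of `\bar ℤ_M` above a place `w ∣ v` of `M`
(`res⁻¹(I_𝔓) = I_𝔔` for the transported prime). Ref: Neukirch, *Algebraic Number Theory*,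
Ch. I §9, (9.4)–(9.6). [folklore] -/
theorem exists_mem_inertia_of_absGaloisRestrict {v : HeightOneSpectrum (𝓞 K)}
    {𝔓 : Ideal (absIntegers (𝓞 K) K)} (h𝔓 : 𝔓 ∈ v.primesAbove) {τ : absoluteGaloisGroup M}
    (hτ : absGaloisRestrict K M τ ∈ 𝔓.inertia (absoluteGaloisGroup K)) :
    ∃ w : HeightOneSpectrum (𝓞 M), w.asIdeal.under (𝓞 K) = v.asIdeal ∧
      ∃ 𝔔 ∈ w.primesAbove, τ ∈ 𝔔.inertia (absoluteGaloisGroup M) := by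
  haveI : 𝔓.IsPrime := h𝔓.1
  haveI : (𝔓.map (absIntegersMap K M)).IsPrime := isPrime_map_absIntegersMap 𝔓
  have hc : (𝔓.map (absIntegersMap K M)).comap (absIntegersMap K M) = 𝔓 :=
    comap_absIntegersMap_map 𝔓
  obtain ⟨w, hw, h𝔔w, -⟩ :=
    exists_heightOneSpectrum_of_comap_absIntegersMap_mem_primesAbove (K := K)
      (𝔔 := 𝔓.map (absIntegersMap K M)) (hc.symm ▸ h𝔓)
  refine ⟨w, hw, _, h𝔔w, ?_⟩
  rw [← comap_inertia_comap_absIntegersMap K M (𝔓.map (absIntegersMap K M)), Subgroup.mem_comap,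
    hc]
  exact hτ

/-- **Frobenius descends along `res`, in residue degree one.**  If `res(τ)`, `τ ∈ Γ_M`, is an
arithmetic Frobenius of `K` at a prime `𝔓 ∣ v` of `\bar ℤ_K`, then there is a place `w ∣ v` of `M`
with `N w = N v` and a prime `𝔔 ∣ w` of `\bar ℤ_M` at which `τ` is an arithmetic Frobenius of `M`.
Ref: Neukirch, *Algebraic Number Theory*, Ch. I §9, (9.4)–(9.5). [folklore] -/
theorem exists_isArithFrobAt_of_absGaloisRestrict {v : HeightOneSpectrum (𝓞 K)}
    {𝔓 : Ideal (absIntegers (𝓞 K) K)} (h𝔓 : 𝔓 ∈ v.primesAbove) {τ : absoluteGaloisGroup M}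
    (hτ : IsArithFrobAt (𝓞 K) (absGaloisRestrict K M τ) 𝔓) :
    ∃ w : HeightOneSpectrum (𝓞 M), w.asIdeal.under (𝓞 K) = v.asIdeal ∧
      w.residueCard = v.residueCard ∧
      ∃ 𝔔 ∈ w.primesAbove, IsArithFrobAt (𝓞 M) τ 𝔔 := by
  haveI : 𝔓.IsPrime := h𝔓.1
  haveI : (𝔓.map (absIntegersMap K M)).IsPrime := isPrime_map_absIntegersMap 𝔓
  have hc : (𝔓.map (absIntegersMap K M)).comap (absIntegersMap K M) = 𝔓 :=
    comap_absIntegersMap_map 𝔓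
  obtain ⟨w, hw, h𝔔w, -⟩ :=
    exists_heightOneSpectrum_of_comap_absIntegersMap_mem_primesAbove (K := K)
      (𝔔 := 𝔓.map (absIntegersMap K M)) (hc.symm ▸ h𝔓)
  have hFq : ∀ z : absIntegers (𝓞 M) M, τ • z - z ^ v.residueCard ∈ 𝔓.map (absIntegersMap K M) := by
    refine (forall_smul_sub_pow_mem_comap_iff K M _ τ v.residueCard).1 fun x => ?_
    rw [hc]
    exact (HeightOneSpectrum.isArithFrobAt_iff_of_mem_primesAbove h𝔓 _).1 hτ x
  have hq : w.residueCard = v.residueCard := residueCard_eq_of_forall_smul_sub_pow_mem hw h𝔔w hFq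
  refine ⟨w, hw, hq, _, h𝔔w, (HeightOneSpectrum.isArithFrobAt_iff_of_mem_primesAbove h𝔔w τ).2 ?_⟩
  rw [hq]
  exact hFq

end PrimeTransport

/-! ### Consequences for framed representations -/

section Framed

variable {K M : Type} [Field K] [NumberField K] [Field M] [NumberField M] [Algebra K M]
variable {A : Type} [CommRing A] [TopologicalSpace A] {n : ℕ}

/-- **Unramified over `M` ⇒ trivial on transported inertia.**  If `σ : Γ_M → GL_n(A)` is
unramified at every place of `M` above `v`, then `σ(τ) = 1` whenever `res(τ)` lies in an inertia
group of `K` at a prime above `v`. [folklore] -/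
theorem apply_eq_one_of_absGaloisRestrict_mem_inertia (σ : FramedGaloisRep M A n)
    {v : HeightOneSpectrum (𝓞 K)}
    (hσ : ∀ w : HeightOneSpectrum (𝓞 M), w.asIdeal.under (𝓞 K) = v.asIdeal → σ.IsUnramifiedAt w)
    {𝔓 : Ideal (absIntegers (𝓞 K) K)} (h𝔓 : 𝔓 ∈ v.primesAbove) {τ : absoluteGaloisGroup M}
    (hτ : absGaloisRestrict K M τ ∈ 𝔓.inertia (absoluteGaloisGroup K)) : σ τ = 1 := by
  obtain ⟨w, hw, 𝔔, h𝔔, hτ𝔔⟩ := exists_mem_inertia_of_absGaloisRestrict h𝔓 hτ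
  exact hσ w hw 𝔔 h𝔔 τ hτ𝔔

variable {ℓ : ℕ} [Fact ℓ.Prime]

/-- **Companions over `M` match at transported Frobenii of degree one.**  Let
`ρ : Γ_K → GL_n(ℚ̄_ℓ)`, `σ : Γ_M → GL_n(ℚ̄_2)` and suppose that at every place `w` of `M` above `v`
the pair `(ρ|_{Γ_M}, σ)` has a common Satake parameter.  If `res(τ)` is an arithmetic Frobenius
of `K` at a prime above `v`, then `charpoly ρ(res τ)` and `charpoly σ(τ)` are the two Frobenius
polynomials attached to one Satake parameter at `N v`. [folklore] -/
theorem exists_charpoly_eq_of_companion (ι : PadicAlgCl ℓ ≃+* ℂ) (ι₂ : PadicAlgCl 2 ≃+* ℂ)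
    (ρ : FramedGaloisRep K (PadicAlgCl ℓ) n) (σ : FramedGaloisRep M (PadicAlgCl 2) n)
    {v : HeightOneSpectrum (𝓞 K)}
    (hmatch : ∀ w : HeightOneSpectrum (𝓞 M), w.asIdeal.under (𝓞 K) = v.asIdeal →
      ∃ α : Multiset ℂ,
        (ρ.restrictField M).HasFrobCharpolyAt w (arithFrobPolyOfSatake ι w.residueCard 1 α) ∧
        σ.HasFrobCharpolyAt w (arithFrobPolyOfSatake ι₂ w.residueCard 1 α))
    {𝔓 : Ideal (absIntegers (𝓞 K) K)} (h𝔓 : 𝔓 ∈ v.primesAbove) {τ : absoluteGaloisGroup M}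
    (hτ : IsArithFrobAt (𝓞 K) (absGaloisRestrict K M τ) 𝔓) :
    ∃ α : Multiset ℂ, FramedRep.charpoly ρ (absGaloisRestrict K M τ) =
        arithFrobPolyOfSatake ι v.residueCard 1 α ∧
      FramedRep.charpoly σ τ = arithFrobPolyOfSatake ι₂ v.residueCard 1 α := by
  obtain ⟨w, hw, hq, 𝔔, h𝔔, hτ𝔔⟩ := exists_isArithFrobAt_of_absGaloisRestrict h𝔓 hτ
  obtain ⟨α, h1, h2⟩ := hmatch w hw
  refine ⟨α, ?_, ?_⟩
  · rw [← hq, ← h1 𝔔 h𝔔 τ hτ𝔔]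
    simp only [FramedRep.charpoly, FramedGaloisRep.restrictField_apply]
  · rw [← hq, ← h2 𝔔 h𝔔 τ hτ𝔔]

end Framed

/-! ### Cofinite bookkeeping along `w ↦ w ∩ K` -/

section Cofinite

variable {K M : Type} [Field K] [Field M] [Algebra K M]

/-- If a property holds at all but finitely many places `w` of `M`, then at all but finitely many
places `v` of `K` it holds at **every** place `w ∣ v` (the bad `w` lie over finitely many `v`).
[folklore] -/
theorem eventually_forall_under {P : HeightOneSpectrum (𝓞 M) → Prop}
    (h : ∀ᶠ w : HeightOneSpectrum (𝓞 M) in Filter.cofinite, P w) :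
    ∀ᶠ v : HeightOneSpectrum (𝓞 K) in Filter.cofinite,
      ∀ w : HeightOneSpectrum (𝓞 M), w.asIdeal.under (𝓞 K) = v.asIdeal → P w := by
  have hfin : {w : HeightOneSpectrum (𝓞 M) | ¬ P w}.Finite := Filter.eventually_cofinite.1 h
  refine Filter.mem_of_superset
    ((hfin.image fun w : HeightOneSpectrum (𝓞 M) => w.under (𝓞 K)).compl_mem_cofinite) ?_
  intro v hv w hw
  by_contra hPw
  apply hv
  refine ⟨w, hPw, HeightOneSpectrum.ext ?_⟩
  rw [HeightOneSpectrum.under_asIdeal]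
  exact hw

end Cofinite

end Summit.Langlands.Langlands.Theorems.BrauerTaylorDescent

end
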